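import Summits.AtomisticToContinuum.Crystallization.Theorems.DisclinationRationUniformPolytypeStabilityGapPinningLevels
import Summits.AtomisticToContinuum.Crystallization.Theorems.DisclinationRationUniformPolytypeStabilityGapPinningForces

/-!
# `UniformPolytypeStability` (stmt-AtomisticToContinuum-15800), line `birth` (v2, cells): stub `stub_gapPinning`, part 6 (rows)

Route `DisclinationRation`, crux `UniformPolytypeStability`, line `birth` (lead prover-line-stmt-AtomisticToContinuum-15800-0).
The configuration-level estimates of the bootstrap (definitions `…GapPinningDefs`, namespace `StubGapPinning`): for a
configuration `L(a,s,z)` in the box and a certificate `P` with `finalCheck P = true`, on the `a`-cell `[ac.1, ac.2] ∋ a`,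

* the reduced gaps `η_k = etaG a z k ∈ [39/50, 17/20]`, their spread `Δ = spread a z`, and the reduced height of a
  level-`t` pair `(z (i+t) − z i)/a = Σ_{r<t} η_{i+r} ∈ It t`, differing between two pairs by at most `t Δ`;
* rows `2 ≤ t ≤ T`: `|row m t − row m' t| ≤ t² L_t Δ + t (osc_t + 2 τ_t)` (Lipschitz + word oscillation + truncation);
* rows `t > T`: `|row m t| ≤ K a⁻⁷ t⁻⁴`, `K = (17/20)(50/39)⁶ C6 T`, and the tail `Σ_{t>T} |row m t − row m' t| ≤ tailT`;
* level `1`: `c₀ |η_m − η_m'| ≤ |calG 1 a η_m − calG 1 a η_m'| + 2 τ₁`.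

Everything is `[folklore]`; theorem-only file; nothing here closes an item.  `stub_gapPinningAux6` is the registered anchor.
-/

noncomputable section

namespace Summit.AtomisticToContinuum.Crystallization.Theorems.UniformPolytypeStabilityCells

namespace StubGapPinning

open scoped BigOperators
open Literature.MathematicalPhysics.StatisticalMechanics

variable {a : ℝ} {s : ℤ → ℤ} {z : ℤ → ℝ}

/-! ## Reduced gaps and their spread -/

/-- `η_k ∈ [39/50, 17/20]` on the box. [folklore] -/
theorem etaG_mem (ha : 0 < a) (hz : HeightBox a z) (k : ℤ) : 39 / 50 ≤ etaG a z k ∧ etaG a z k ≤ 17 / 20 := by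
  obtain ⟨h1, h2⟩ := hz k
  rw [etaG, gap, le_div_iff₀ ha, div_le_iff₀ ha]
  exact ⟨by linarith, by linarith⟩

/-- The reduced height of a level-`t` pair is the sum of its `t` reduced gaps. [folklore] -/
theorem height_div_eq_sum (ha : a ≠ 0) (z : ℤ → ℝ) (i : ℤ) (t : ℕ) :
    (z (i + t) - z i) / a = ∑ r ∈ Finset.range t, etaG a z (i + r) := by
  induction t with
  | zero => simp
  | succ n ih =>
    rw [Finset.sum_range_succ, ← ih, etaG, gap]
    push_cast
    field_simp
    ring

/-- The reduced height of a level-`t` pair lies in `It t = [39t/50, 17t/20]`. [folklore] -/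
theorem height_div_mem (ha : 0 < a) (hz : HeightBox a z) (i : ℤ) (t : ℕ) :
    (((It t).1 : ℚ) : ℝ) ≤ (z (i + t) - z i) / a ∧ (z (i + t) - z i) / a ≤ (((It t).2 : ℚ) : ℝ) := by
  rw [height_div_eq_sum ha.ne', It]
  push_cast
  constructor
  · calc (39 : ℝ) * t / 50 = ∑ _r ∈ Finset.range t, (39 / 50 : ℝ) := by
          rw [Finset.sum_const, Finset.card_range, nsmul_eq_mul]; ring
      _ ≤ _ := Finset.sum_le_sum fun r _ => (etaG_mem ha hz (i + r)).1
  · calc ∑ r ∈ Finset.range t, etaG a z (i + r) ≤ ∑ _r ∈ Finset.range t, (17 / 20 : ℝ) :=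
          Finset.sum_le_sum fun r _ => (etaG_mem ha hz (i + r)).2
      _ = 17 * t / 20 := by rw [Finset.sum_const, Finset.card_range, nsmul_eq_mul]; ring

/-- Two level-`t` heights differ by at most `t Δ` when all gaps differ by at most `Δ`. [folklore] -/
theorem abs_height_div_sub_le (ha : a ≠ 0) (i i' : ℤ) (t : ℕ) {Δ : ℝ} (hΔ : ∀ k k', |etaG a z k - etaG a z k'| ≤ Δ) :
    |(z (i + t) - z i) / a - (z (i' + t) - z i') / a| ≤ t * Δ := by
  rw [height_div_eq_sum ha, height_div_eq_sum ha, ← Finset.sum_sub_distrib]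
  refine (Finset.abs_sum_le_sum_abs _ _).trans ?_
  calc ∑ r ∈ Finset.range t, |etaG a z (i + r) - etaG a z (i' + r)| ≤ ∑ _r ∈ Finset.range t, Δ :=
        Finset.sum_le_sum fun r _ => hΔ _ _
    _ = t * Δ := by rw [Finset.sum_const, Finset.card_range, nsmul_eq_mul]

/-- The spread `Δ = sup |η_k − η_k'|`: it bounds every difference, is nonnegative, and is the least such bound. [folklore] -/
theorem spread_spec (ha : 0 < a) (hz : HeightBox a z) :
    (∀ k k', |etaG a z k - etaG a z k'| ≤ spread a z) ∧ 0 ≤ spread a z ∧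
      ∀ B : ℝ, (∀ k k', |etaG a z k - etaG a z k'| ≤ B) → spread a z ≤ B := by
  have hbdd : BddAbove (Set.range fun kk : ℤ × ℤ => |etaG a z kk.1 - etaG a z kk.2|) := by
    refine ⟨7 / 100, ?_⟩
    rintro x ⟨kk, rfl⟩
    have h1 := etaG_mem ha hz kk.1
    have h2 := etaG_mem ha hz kk.2
    rw [abs_le]; constructor <;> linarith
  have hle : ∀ k k', |etaG a z k - etaG a z k'| ≤ spread a z := fun k k' =>
    le_ciSup (f := fun kk : ℤ × ℤ => |etaG a z kk.1 - etaG a z kk.2|) hbdd (k, k')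
  refine ⟨hle, (abs_nonneg _).trans (hle 0 0), fun B hB => ?_⟩
  exact ciSup_le fun kk => hB kk.1 kk.2

/-! ## The registry class of a pair -/

/-- `cls c ∈ {0, 1}`. [folklore] -/
theorem cls_cases (c : ℤ) : cls c = 0 ∨ cls c = 1 := by
  unfold cls; split_ifs <;> simp

/-- `calG` depends on `c` only through its class. [folklore] -/
theorem calG_cls (c : ℤ) (a η : ℝ) : calG c a η = calG (cls c) a η := by
  rw [calG, calG, Alat_cls 4, Alat_cls 7]

/-! ## One pair of the far rows -/

section acell

variable {P : Prm} {ac : ℚ × ℚ}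

/-- The `a`-cell data in real form: `0 < a`, `ia₂ = ac.2⁻¹ ≤ a⁻¹ ≤ ia₁ = ac.1⁻¹`, `0 < ia₂`. [folklore] -/
theorem acell_real (hP : finalCheck P = true) (hac : ac ∈ P.acells) (ha : 47 / 50 ≤ a)
    (hlo : ((ac.1 : ℚ) : ℝ) ≤ a) (hhi : a ≤ ((ac.2 : ℚ) : ℝ)) :
    0 < a ∧ (0 : ℝ) < ((ac.2⁻¹ : ℚ) : ℝ) ∧ (((ac.2⁻¹ : ℚ)) : ℝ) ≤ a⁻¹ ∧ a⁻¹ ≤ ((ac.1⁻¹ : ℚ) : ℝ) ∧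
      (0 : ℚ) < ac.1⁻¹ := by
  obtain ⟨-, -, -, -, -, -, hall⟩ := finalCheck_spec hP
  obtain ⟨h0, h12, -, -, -⟩ := aCellOK_spec (hall ac hac)
  have ha0 : 0 < a := by linarith
  have h0' : (0 : ℝ) < ac.1 := by exact_mod_cast h0
  have h2' : (0 : ℝ) < ac.2 := by exact_mod_cast (h0.trans_le h12)
  push_cast
  exact ⟨ha0, inv_pos.2 h2', inv_anti₀ ha0 hhi, inv_anti₀ h0' hlo, inv_pos.2 h0⟩

/-- **One pair, level `2 ≤ t ≤ T`**: `|lf i (i+t) − lf i' (i'+t)| ≤ L_t |η − η'| + osc_t + 2 τ_t`. [folklore] -/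
theorem abs_lf_sub_lf_le (hP : finalCheck P = true) (hac : ac ∈ P.acells) (ha : 47 / 50 ≤ a) (ha1 : a ≤ 1)
    (hlo : ((ac.1 : ℚ) : ℝ) ≤ a) (hhi : a ≤ ((ac.2 : ℚ) : ℝ)) (hz : HeightBox a z)
    {t : ℕ} (h2 : 2 ≤ t) (hT : t ≤ P.T) (i i' : ℤ) :
    |lf a s z i (i + t) - lf a s z i' (i' + t)| ≤
      ((LT P ac.1⁻¹ ac.2⁻¹ t : ℚ) : ℝ) * |(z (i + t) - z i) / a - (z (i' + t) - z i') / a| +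
        ((oscT P ac.1⁻¹ ac.2⁻¹ t : ℚ) : ℝ) + 2 * ((tauT ac.1⁻¹ (P.Nt t) t : ℚ) : ℝ) := by
  obtain ⟨ha0, hia₂, hle₂, hle₁, hia₁⟩ := acell_real hP hac ha hlo hhi
  obtain ⟨-, -, -, -, hlev, -, -⟩ := finalCheck_spec hP
  obtain ⟨hN, hcov, hok⟩ := hlev t h2 hT
  set η : ℝ := (z (i + t) - z i) / a with hη
  set η' : ℝ := (z (i' + t) - z i') / a with hη'
  obtain ⟨hη1, hη2⟩ := height_div_mem ha0 hz i t
  obtain ⟨hη1', hη2'⟩ := height_div_mem ha0 hz i' t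
  rw [← hη] at hη1 hη2
  rw [← hη'] at hη1' hη2'
  set r := cls (haggLabel s i - haggLabel s (i + t)) with hr
  set r' := cls (haggLabel s i' - haggLabel s (i' + t)) with hr'
  have hlf : lf a s z i (i + t) = calG r a η := by rw [lf_eq_calG ha0, calG_cls]
  have hlf' : lf a s z i' (i' + t) = calG r' a η' := by rw [lf_eq_calG ha0, calG_cls]
  have hIt : (0 : ℚ) < (It t).1 := by
    have : (2 : ℚ) ≤ t := by exact_mod_cast h2
    simp only [It]; linarith
  set N := P.Nt t
  -- the four pieces
  have htail : ∀ {ρ : ℤ}, |ρ| ≤ 1 → ∀ {x : ℝ}, (((It t).1 : ℚ) : ℝ) ≤ x → x ≤ (((It t).2 : ℚ) : ℝ) →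
      |calG ρ a x - FN N ρ a x| ≤ ((tauT ac.1⁻¹ N t : ℚ) : ℝ) := by
    intro ρ hρ x hx1 hx2
    have h := abs_calG_sub_FN_le hρ hN ha0 ha1 hle₁ hIt hx1 hx2
    rwa [tauT]
  have hlip : |FN N r a η - FN N r a η'| ≤ ((LT P ac.1⁻¹ ac.2⁻¹ t : ℚ) : ℝ) * |η - η'| :=
    abs_FN_sub_FN_le hcov hok ha0 hia₂ hle₂ hle₁ (cls_cases _) hη1 hη2 hη1' hη2'
  have hosc : |FN N r a η' - FN N r' a η'| ≤ ((oscT P ac.1⁻¹ ac.2⁻¹ t : ℚ) : ℝ) := by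
    have h01 := abs_FN_sub_le_oscOf hcov hok ha0 hia₂ hle₂ hle₁ hη1' hη2'
    have h0 : (0 : ℝ) ≤ ((oscT P ac.1⁻¹ ac.2⁻¹ t : ℚ) : ℝ) := by exact_mod_cast (LOf_nonneg _ _ _ _).2
    rcases cls_cases (haggLabel s i - haggLabel s (i + t)) with h | h <;>
      rcases cls_cases (haggLabel s i' - haggLabel s (i' + t)) with h' | h' <;>
      simp only [hr, hr', h, h'] <;> first
        | simpa using h0
        | exact h01
        | (rw [abs_sub_comm]; exact h01)
  have e1 := htail (abs_cls_le (haggLabel s i - haggLabel s (i + t))) hη1 hη2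
  have e2 := htail (abs_cls_le (haggLabel s i' - haggLabel s (i' + t))) hη1' hη2'
  rw [hlf, hlf']
  have key : calG r a η - calG r' a η' = (calG r a η - FN N r a η) + (FN N r a η - FN N r a η') +
      (FN N r a η' - FN N r' a η') - (calG r' a η' - FN N r' a η') := by ring
  rw [key]
  refine (abs_sub _ _).trans ?_
  refine (add_le_add ((abs_add_three _ _ _).trans (add_le_add (add_le_add e1 hlip) hosc)) e2).trans ?_
  linarith

/-- **Row difference, level `2 ≤ t ≤ T`**: `|row m t − row m' t| ≤ t² L_t Δ + t (osc_t + 2 τ_t)`. [folklore] -/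
theorem abs_row_sub_row_le (hP : finalCheck P = true) (hac : ac ∈ P.acells) (ha : 47 / 50 ≤ a) (ha1 : a ≤ 1)
    (hlo : ((ac.1 : ℚ) : ℝ) ≤ a) (hhi : a ≤ ((ac.2 : ℚ) : ℝ)) (hz : HeightBox a z)
    {t : ℕ} (h2 : 2 ≤ t) (hT : t ≤ P.T) (m m' : ℤ) {Δ : ℝ}
    (hΔ : ∀ k k', |etaG a z k - etaG a z k'| ≤ Δ) :
    |row a s z m t - row a s z m' t| ≤
      (t : ℝ) ^ 2 * ((LT P ac.1⁻¹ ac.2⁻¹ t : ℚ) : ℝ) * Δ +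
        t * (((oscT P ac.1⁻¹ ac.2⁻¹ t : ℚ) : ℝ) + 2 * ((tauT ac.1⁻¹ (P.Nt t) t : ℚ) : ℝ)) := by
  obtain ⟨ha0, -⟩ := acell_real hP hac ha hlo hhi
  have hL : (0 : ℝ) ≤ ((LT P ac.1⁻¹ ac.2⁻¹ t : ℚ) : ℝ) := by exact_mod_cast (LOf_nonneg _ _ _ _).1
  rw [row, row, ← Finset.sum_sub_distrib]
  refine (Finset.abs_sum_le_sum_abs _ _).trans ?_
  have hterm : ∀ k ∈ Finset.range t, |lf a s z (m - k) (m - k + t) - lf a s z (m' - k) (m' - k + t)| ≤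
      ((LT P ac.1⁻¹ ac.2⁻¹ t : ℚ) : ℝ) * (t * Δ) +
        (((oscT P ac.1⁻¹ ac.2⁻¹ t : ℚ) : ℝ) + 2 * ((tauT ac.1⁻¹ (P.Nt t) t : ℚ) : ℝ)) := by
    intro k _
    have h := abs_lf_sub_lf_le hP hac ha ha1 hlo hhi hz (s := s) h2 hT (m - k) (m' - k)
    have hd := abs_height_div_sub_le (z := z) ha0.ne' (m - k) (m' - k) t hΔ
    nlinarith [mul_le_mul_of_nonneg_left hd hL]
  refine (Finset.sum_le_sum hterm).trans ?_
  rw [Finset.sum_const, Finset.card_range, nsmul_eq_mul]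
  ring_nf
  rfl

/-- **One pair, level `t > T`**: `|lf i (i+t)| ≤ K a⁻⁷ t⁻⁵` with `K = (17/20)(50/39)⁶ C6 T`. [folklore] -/
theorem abs_lf_le_far (hP : finalCheck P = true) (ha : 47 / 50 ≤ a) (ha1 : a ≤ 1) (hz : HeightBox a z) {t : ℕ} (hT : P.T + 1 ≤ t) (i : ℤ) :
    |lf a s z i (i + t)| ≤ (17 / 20 * (50 / 39) ^ 6 * ((C6 P.T : ℚ) : ℝ)) * (a⁻¹) ^ 7 * ((t : ℝ)⁻¹) ^ 5 := by
  obtain ⟨hT2, -⟩ := finalCheck_spec hP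
  have ha0 : 0 < a := by linarith
  set η : ℝ := (z (i + t) - z i) / a with hη
  obtain ⟨hη1, hη2⟩ := height_div_mem ha0 hz i t
  rw [← hη] at hη1 hη2
  simp only [It] at hη1 hη2; push_cast at hη1 hη2
  have ht3 : (3 : ℝ) ≤ t := by exact_mod_cast (show 3 ≤ t by omega)
  have ht0 : (0 : ℝ) < t := by linarith
  set η₀ : ℝ := 39 * ((P.T + 1 : ℕ) : ℝ) / 50 with hη₀
  have hη₀pos : 0 < η₀ := by rw [hη₀]; positivity
  have hη₀le : η₀ ≤ η := by
    have : ((P.T + 1 : ℕ) : ℝ) ≤ t := by exact_mod_cast hT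
    rw [hη₀]; nlinarith
  have hηpos : 0 < η := by nlinarith
  have hainv : a⁻¹ ≤ η := by
    have : a⁻¹ ≤ 50 / 47 := by rw [inv_le_comm₀ ha0 (by norm_num)]; norm_num; linarith
    nlinarith
  rw [lf_eq_calG ha0, calG_cls, ← hη]
  have h1 := abs_calG_le (c := cls (haggLabel s i - haggLabel s (i + t))) ha0 ha1 hainv
  have h2 := Alat_four_le (abs_cls_le (haggLabel s i - haggLabel s (i + t))) hηpos
  -- `49 η⁻⁸ + β₄ η⁻⁶ ≤ C6 η⁻⁶`
  have hC6 : ((C6 P.T : ℚ) : ℝ) = 49 / η₀ ^ 2 + 128 / 57 := by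
    simp only [C6, It, betaC, hη₀]; push_cast; ring
  have hinvη : η⁻¹ ≤ η₀⁻¹ := inv_anti₀ hη₀pos hη₀le
  have hA : Alat 4 (cls (haggLabel s i - haggLabel s (i + t))) η ≤ ((C6 P.T : ℚ) : ℝ) * (η⁻¹) ^ 6 := by
    rw [hC6]
    have : (η⁻¹) ^ 8 ≤ (η₀⁻¹) ^ 2 * (η⁻¹) ^ 6 := by
      rw [show (η⁻¹) ^ 8 = (η⁻¹) ^ 2 * (η⁻¹) ^ 6 by ring]
      exact mul_le_mul_of_nonneg_right (pow_le_pow_left₀ (inv_nonneg.2 hηpos.le) hinvη 2) (by positivity)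
    rw [show (49 : ℝ) / η₀ ^ 2 = 49 * (η₀⁻¹) ^ 2 by rw [inv_pow]; ring]
    nlinarith [this]
  -- `η⁻⁵ ≤ (17/20)(50/39)⁶ t⁻⁵`
  have hη5 : η * (η⁻¹) ^ 6 ≤ 17 / 20 * (50 / 39) ^ 6 * ((t : ℝ)⁻¹) ^ 5 := by
    rw [show η * (η⁻¹) ^ 6 = (η⁻¹) ^ 5 by field_simp]
    have h39 : η⁻¹ ≤ 50 / 39 * (t : ℝ)⁻¹ := by
      rw [inv_le_comm₀ hηpos (by positivity), mul_inv, inv_inv]; linarith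
    calc (η⁻¹) ^ 5 ≤ (50 / 39 * (t : ℝ)⁻¹) ^ 5 := pow_le_pow_left₀ (inv_nonneg.2 hηpos.le) h39 5
      _ = (50 / 39) ^ 5 * ((t : ℝ)⁻¹) ^ 5 := by ring
      _ ≤ 17 / 20 * (50 / 39) ^ 6 * ((t : ℝ)⁻¹) ^ 5 := by
          apply mul_le_mul_of_nonneg_right (by norm_num) (by positivity)
  have hC60 : (0 : ℝ) ≤ ((C6 P.T : ℚ) : ℝ) := by rw [hC6]; positivity
  calc |calG (cls (haggLabel s i - haggLabel s (i + t))) a η|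
      ≤ η * (a⁻¹) ^ 7 * Alat 4 (cls (haggLabel s i - haggLabel s (i + t))) η := h1
    _ ≤ η * (a⁻¹) ^ 7 * (((C6 P.T : ℚ) : ℝ) * (η⁻¹) ^ 6) := mul_le_mul_of_nonneg_left hA (by positivity)
    _ = ((C6 P.T : ℚ) : ℝ) * (a⁻¹) ^ 7 * (η * (η⁻¹) ^ 6) := by ring
    _ ≤ ((C6 P.T : ℚ) : ℝ) * (a⁻¹) ^ 7 * (17 / 20 * (50 / 39) ^ 6 * ((t : ℝ)⁻¹) ^ 5) :=
        mul_le_mul_of_nonneg_left hη5 (by positivity)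
    _ = _ := by ring

/-- **Row, level `t > T`**: `|row m t| ≤ K a⁻⁷ t⁻⁴`. [folklore] -/
theorem abs_row_le_far (hP : finalCheck P = true) (ha : 47 / 50 ≤ a) (ha1 : a ≤ 1) (hz : HeightBox a z) {t : ℕ} (hT : P.T + 1 ≤ t) (m : ℤ) :
    |row a s z m t| ≤ (17 / 20 * (50 / 39) ^ 6 * ((C6 P.T : ℚ) : ℝ)) * (a⁻¹) ^ 7 * ((t : ℝ)⁻¹) ^ 4 := by
  have ht0 : (0 : ℝ) < t := by exact_mod_cast (show 0 < t by omega)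
  rw [row]
  refine (Finset.abs_sum_le_sum_abs _ _).trans ?_
  calc ∑ k ∈ Finset.range t, |lf a s z (m - k) (m - k + t)|
      ≤ ∑ _k ∈ Finset.range t, (17 / 20 * (50 / 39) ^ 6 * ((C6 P.T : ℚ) : ℝ)) * (a⁻¹) ^ 7 * ((t : ℝ)⁻¹) ^ 5 :=
        Finset.sum_le_sum fun k _ => abs_lf_le_far hP ha ha1 hz (s := s) hT (m - k)
    _ = _ := by rw [Finset.sum_const, Finset.card_range, nsmul_eq_mul]; field_simp

/-- **Far tail of the row differences**: `Σ_{j} |row m (j+T+1) − row m' (j+T+1)| ≤ tailT`, summable. [folklore] -/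
theorem tsum_far_le (hP : finalCheck P = true) (hac : ac ∈ P.acells) (ha : 47 / 50 ≤ a) (ha1 : a ≤ 1)
    (hlo : ((ac.1 : ℚ) : ℝ) ≤ a) (hhi : a ≤ ((ac.2 : ℚ) : ℝ)) (hz : HeightBox a z) (m m' : ℤ) :
    Summable (fun j : ℕ => |row a s z m (j + (P.T + 1)) - row a s z m' (j + (P.T + 1))|) ∧
      ∑' j : ℕ, |row a s z m (j + (P.T + 1)) - row a s z m' (j + (P.T + 1))| ≤ ((tailT ac.1⁻¹ P.T : ℚ) : ℝ) := by
  obtain ⟨ha0, -, -, hle₁, hia₁⟩ := acell_real hP hac ha hlo hhi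
  obtain ⟨hT2, -⟩ := finalCheck_spec hP
  set K : ℝ := 17 / 20 * (50 / 39) ^ 6 * ((C6 P.T : ℚ) : ℝ) with hK
  have hK0 : 0 ≤ K := by rw [hK]; have := C6_pos P.T; positivity
  have hia₁' : (0 : ℝ) ≤ ((ac.1⁻¹ : ℚ) : ℝ) := by exact_mod_cast hia₁.le
  have h7 : (a⁻¹) ^ 7 ≤ (((ac.1⁻¹ : ℚ)) : ℝ) ^ 7 := pow_le_pow_left₀ (inv_nonneg.2 ha0.le) hle₁ 7
  set g : ℕ → ℝ := fun j => 2 * K * (((ac.1⁻¹ : ℚ)) : ℝ) ^ 7 * ((((j + P.T + 1 : ℕ) : ℝ))⁻¹) ^ 4 with hg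
  obtain ⟨hgs, hgle⟩ := tsum_inv_pow_four_le (T := P.T) (by omega)
  have hbound : ∀ j : ℕ, |row a s z m (j + (P.T + 1)) - row a s z m' (j + (P.T + 1))| ≤ g j := by
    intro j
    have e : ((j + (P.T + 1) : ℕ) : ℝ) = ((j + P.T + 1 : ℕ) : ℝ) := by push_cast; ring
    have h1 := abs_row_le_far hP ha ha1 hz (s := s) (t := j + (P.T + 1)) (by omega) m
    have h2 := abs_row_le_far hP ha ha1 hz (s := s) (t := j + (P.T + 1)) (by omega) m'
    rw [← hK, e] at h1 h2
    have hx : 0 ≤ ((((j + P.T + 1 : ℕ) : ℝ))⁻¹) ^ 4 := by positivity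
    calc |row a s z m (j + (P.T + 1)) - row a s z m' (j + (P.T + 1))|
        ≤ |row a s z m (j + (P.T + 1))| + |row a s z m' (j + (P.T + 1))| := abs_sub _ _
      _ ≤ 2 * (K * (a⁻¹) ^ 7 * ((((j + P.T + 1 : ℕ) : ℝ))⁻¹) ^ 4) := by linarith
      _ ≤ g j := by
          rw [hg]
          nlinarith [mul_le_mul_of_nonneg_left h7 (mul_nonneg hK0 hx)]
  have hgsum : Summable g := (hgs.mul_left _)
  have hs : Summable (fun j : ℕ => |row a s z m (j + (P.T + 1)) - row a s z m' (j + (P.T + 1))|) :=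
    Summable.of_nonneg_of_le (fun j => abs_nonneg _) hbound hgsum
  refine ⟨hs, (hs.tsum_le_tsum hbound hgsum).trans ?_⟩
  rw [hg, tsum_mul_left]
  have hT0 : (P.T : ℝ) ≠ 0 := by exact_mod_cast (show P.T ≠ 0 by omega)
  have htail : ((tailT ac.1⁻¹ P.T : ℚ) : ℝ) = 2 * K * (((ac.1⁻¹ : ℚ)) : ℝ) ^ 7 * (((P.T : ℝ)⁻¹) ^ 3 / 3) := by
    rw [tailT, hK]; push_cast; field_simp
  rw [htail]
  exact mul_le_mul_of_nonneg_left hgle (by positivity)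

end acell

end StubGapPinning

/-- Registered anchor `stub_gapPinningAux6` of the rows file of `stub_gapPinning`: the reduced height of a level-`t`
pair is the sum of its reduced gaps. [folklore] -/
theorem stub_gapPinningAux6 : ∀ (a : ℝ) (z : ℤ → ℝ) (i : ℤ) (t : ℕ), a ≠ 0 →
    (z (i + t) - z i) / a = ∑ r ∈ Finset.range t, StubGapPinning.etaG a z (i + r) :=
  fun _ z i t ha => StubGapPinning.height_div_eq_sum ha z i t

end Summit.AtomisticToContinuum.Crystallization.Theorems.UniformPolytypeStabilityCells

end
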